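import Summits.QuantumFields.BalabanUV.Beta.FP.KernelReflectionBounded

/-!
# `BalabanUV.Beta.FP.KernelReflectionBoundedContact` — road «FP» for binder row D1, sub-row **H2-ASM-5a** (Kcov), module R5 ([folklore]): the covariance of the resolvent Hessian of a
# BOUNDED leg when the first-order vertex family reflects WITH A CONTACT — `V μ (ρ μ y) = σ μ • refK Φ (V μ y + Ct μ y)` — as an EXACT identity with the three cross words displayed,
# its difference-variable form, and the `AxisReflectionCovariant` corollary when the cross words vanish

HONEST DEPENDENCY (page 1, mandatory): continuum YM on T⁴ ⇐ BetaPertH ∧ nine spine estimates (0/9 proved); BetaPertH ⇐ (D1) ∧ (D4) ∧ CAP+tail;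
G-an2-4 gates asym, D1 and NE2/3/4.  HONEST FRAMING (cell contract, verbatim): «discharging `BetaPertH` makes Bałaban's UV stability UNCONDITIONAL —
a real constructive-QFT result; it is NOT the continuum limit and NOT the Clay problem.»  THIS MODULE DISCHARGES NOTHING of the wall: [folklore] bilinear bookkeeping over R1
(`KernelReflectionBounded.bubble_refK_bdd`∕`tadpole_refK_bdd`), an2's slice lemmas (`KernelWard`) and gan24-leaf-02's right-localised bricks (`KernelWardBoundedBricks`); 0 def,
0 `def … : Prop`, nothing cited, 0 sorry; 0∕4 row-D1 binders; NOT the contact family of any jet, NOT hasym, NOT D1, NOT BetaPertH, NOT continuum, NOT Clay.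

ABSOLUTE RULE (cell charter, verbatim): «No internally-minted statement may enter as a cited fact. Every hypothesis is either kernel-proved in this package or a
verbatim quotation of a PUBLISHED theorem with page reference. The manuscript(s) under audit are NOT citable for their own disputed steps — they are the thing
under adjudication; programme-internal (2001/route/tribunal) claims are never citable.»

WHY (R-FP-33 (c) exception invoked by name, journal INTENT R5: the GLUON sector of (Kcov) at `K := PiBF` cannot be instantiated through the PLAIN first-order socket of R1∕R2a∕R3a).
The tree's gluon first-order data reflect WITH A SAME-BOND CONTACT under the cell's leg map — `WilsonReflectionContact.wilsonA_bref :
wilsonA d κ′ (bref α κ′ u) = ε_κ′ • refK (Φ N α) (wilsonA d κ′ u + (−½) • wilsonCt d α κ′ u)` (an2's (Sr-conj) shape) — and so, presumably, will the perfect action's cubic jets of H2V-4 in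
the `exp` parametrisation.  With a contact, the bubble of the reflected vertices expands bilinearly into the original bubble plus three CROSS WORDS; this file records that
expansion for a bounded leg (the `Spr`-leg version `TameKernelCalculus.bubble_add_left∕right` excludes the power-law `Pker`), leaving the cross words to the consumer's rules.
CONTENT: §1 `comp_add_right_of_slices`, `tr_add_of_summable` (the left twin is an3's `VertexReflectionContact.comp_add_left`, used inline), **`bubble_add_left_bdd`**, **`bubble_add_right_bdd`** (bounded leg, vertices bi-localised at common
points); §2 **`hess_refl_bdd_contact`** — `hess A V W μ (ρ μ y) ν (ρ ν y′) = σ μ σ ν · (hess A V W μ y ν y′ − ½·(bubble A (Ct μ y) (V ν y′) + bubble A (V μ y) (Ct ν y′) + bubble A (Ct μ y) (Ct ν y′)))`;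
§3 **`hessKer_refl_bdd_contact`** (difference-variable form, bond map `bondRefl α c`, signs `reflSign α`, cross words at base point `0`); §4 **`axisReflectionCovariant_flip_hessKer_bdd_contact`**:
if for every axis the displayed cross-word kernel VANISHES, `AxisReflectionCovariant (fun μ ν z => hessKer A V W μ ν (−z))`.
Provenance: D1 formalisation swarm seat b2b-balaban-beta-d1-formalise-leaf-02 gen 9 (road FP engine lineage; sub-row H2-ASM-5a (Kcov) REFLECTION HALF), 2026-08-21.
-/

noncomputable section

namespace Summit.QuantumFields.BalabanUV.Beta.FP.KernelReflectionBoundedContact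

open Finset
open scoped BigOperators
open Literature.MathematicalPhysics.QuantumFieldTheory.Balaban1983to89
open Literature.MathematicalPhysics.QuantumFieldTheory.Balaban1983to89.Beta
open B12Sec2to5 (l1 l1_nonneg)
open B6BondElimination (unitVec unitVec_apply)
open PolarizationSign (axisReflect axisReflect_apply reflSign AxisReflectionCovariant)
open ExpKernelCalculus (MKer Site Decays BiLoc comp tr bubble tadpole VertexFamily VertexFamily₂ hess hessKer BlockCovariant Zl hess_eq_hessKer summable_exp_shift')
open KernelReflection (LegMap refK refK_apply tadpole_smul bubble_smul_left bubble_smul_right bondRefl bondRefl_sub)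
open KernelWard (Bdd biLoc_add slices_bdd_biLoc)
open Summit.QuantumFields.BalabanUV.Beta.FP.KernelWardBoundedBricks (slices_rl_bdd bdd_of_rl summable_trTerm_rl rl_sub)
open Summit.QuantumFields.BalabanUV.Beta.D1BFx.ContactCount (abs_comp_le_of_entryBound abs_comp_le_of_rightLoc)
open Summit.QuantumFields.BalabanUV.Beta.FP.KernelReflectionBounded (bubble_refK_bdd tadpole_refK_bdd)

variable {D : ℕ} {F : Type*} [Fintype F]

/-! ## §1 Bilinearity of the bubble for a bounded leg -/

/-- [folklore] `A ∘ (K + L) = A ∘ K + A ∘ L` given fibre-summed slice summability of both products. -/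
theorem comp_add_right_of_slices {A K L : MKer D F} (hK : ∀ x z a b, Summable fun y : Fin D → ℤ => ∑ f, A x y a f * K y z f b)
    (hL : ∀ x z a b, Summable fun y : Fin D → ℤ => ∑ f, A x y a f * L y z f b) : comp A (K + L) = comp A K + comp A L := by
  funext x z a b
  show (∑' y, ∑ f, A x y a f * (K + L) y z f b) = (∑' y, ∑ f, A x y a f * K y z f b) + ∑' y, ∑ f, A x y a f * L y z f b
  rw [← (hK x z a b).tsum_add (hL x z a b)]
  refine tsum_congr fun y => ?_
  rw [← Finset.sum_add_distrib]
  refine Finset.sum_congr rfl fun f _ => ?_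
  simp only [Pi.add_apply]
  ring

/-- [folklore] `tr (K + L) = tr K + tr L` given summability of both fibre-summed diagonals. -/
theorem tr_add_of_summable {K L : MKer D F} (hK : Summable fun x : Fin D → ℤ => ∑ a, K x x a a)
    (hL : Summable fun x : Fin D → ℤ => ∑ a, L x x a a) : tr (K + L) = tr K + tr L := by
  show (∑' x, ∑ a, (K + L) x x a a) = (∑' x, ∑ a, K x x a a) + ∑' x, ∑ a, L x x a a
  rw [← hK.tsum_add hL]
  refine tsum_congr fun x => ?_
  rw [← Finset.sum_add_distrib]
  refine Finset.sum_congr rfl fun a _ => ?_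
  simp only [Pi.add_apply]

/-- [folklore] **ADDITIVITY OF THE BUBBLE IN THE FIRST VERTEX, BOUNDED LEG**: `bubble A (V + K) W = bubble A V W + bubble A K W` for `Bdd A C`, `V`, `K` bi-localised at `(p,p)`
and `W` at `(q,q)` (the composed kernels are right-localised; every re-arranged series converges absolutely). -/
theorem bubble_add_left_bdd {A V K W : MKer D F} {C Cv Ck Cw δ : ℝ} {p q : Fin D → ℤ} (hA : Bdd A C)
    (hV : BiLoc V p p Cv δ) (hK : BiLoc K p p Ck δ) (hW : BiLoc W q q Cw δ) (hδ : 0 < δ) :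
    bubble A (V + K) W = bubble A V W + bubble A K W := by
  classical
  rcases isEmpty_or_nonempty F with hF | ⟨⟨a₀⟩⟩
  · simp [ExpKernelCalculus.bubble, ExpKernelCalculus.tr]
  have hC : 0 ≤ C := (abs_nonneg _).trans (hA p p a₀ a₀)
  have hXV := abs_comp_le_of_entryBound hC hA hV hδ
  have hXK := abs_comp_le_of_entryBound hC hA hK hδ
  have hY := abs_comp_le_of_entryBound hC hA hW hδ
  have hYb := bdd_of_rl hY hδ.le
  have e1 : comp A (V + K) = comp A V + comp A K := comp_add_right_of_slices (slices_bdd_biLoc hA hV hδ) (slices_bdd_biLoc hA hK hδ)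
  -- `(K + L) ∘ M = K ∘ M + L ∘ M` for the right-localised composed kernels (an3's `VertexReflectionContact.comp_add_left`, restated inline to keep the import cone small)
  have e2 : comp (comp A V + comp A K) (comp A W) = comp (comp A V) (comp A W) + comp (comp A K) (comp A W) := by
    have hs₁ := slices_rl_bdd hXV hYb hδ
    have hs₂ := slices_rl_bdd hXK hYb hδ
    funext x z a b
    show (∑' y, ∑ f, (comp A V + comp A K) x y a f * comp A W y z f b)
      = (∑' y, ∑ f, comp A V x y a f * comp A W y z f b) + ∑' y, ∑ f, comp A K x y a f * comp A W y z f b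
    rw [← (hs₁ x z a b).tsum_add (hs₂ x z a b)]
    refine tsum_congr fun y => ?_
    rw [← Finset.sum_add_distrib]
    refine Finset.sum_congr rfl fun f _ => ?_
    simp only [Pi.add_apply]
    ring
  unfold ExpKernelCalculus.bubble
  rw [e1, e2]
  exact tr_add_of_summable (summable_trTerm_rl (abs_comp_le_of_rightLoc hXV hY hδ) hδ) (summable_trTerm_rl (abs_comp_le_of_rightLoc hXK hY hδ) hδ)

/-- [folklore] **ADDITIVITY OF THE BUBBLE IN THE SECOND VERTEX, BOUNDED LEG**: `bubble A V (W + K) = bubble A V W + bubble A V K`. -/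
theorem bubble_add_right_bdd {A V W K : MKer D F} {C Cv Cw Ck δ : ℝ} {p q : Fin D → ℤ} (hA : Bdd A C)
    (hV : BiLoc V p p Cv δ) (hW : BiLoc W q q Cw δ) (hK : BiLoc K q q Ck δ) (hδ : 0 < δ) :
    bubble A V (W + K) = bubble A V W + bubble A V K := by
  classical
  rcases isEmpty_or_nonempty F with hF | ⟨⟨a₀⟩⟩
  · simp [ExpKernelCalculus.bubble, ExpKernelCalculus.tr]
  have hC : 0 ≤ C := (abs_nonneg _).trans (hA p p a₀ a₀)
  have hXV := abs_comp_le_of_entryBound hC hA hV hδ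
  have hYW := abs_comp_le_of_entryBound hC hA hW hδ
  have hYK := abs_comp_le_of_entryBound hC hA hK hδ
  have e1 : comp A (W + K) = comp A W + comp A K := comp_add_right_of_slices (slices_bdd_biLoc hA hW hδ) (slices_bdd_biLoc hA hK hδ)
  have e2 : comp (comp A V) (comp A W + comp A K) = comp (comp A V) (comp A W) + comp (comp A V) (comp A K) :=
    comp_add_right_of_slices (slices_rl_bdd hXV (bdd_of_rl hYW hδ.le) hδ) (slices_rl_bdd hXV (bdd_of_rl hYK hδ.le) hδ)
  unfold ExpKernelCalculus.bubble
  rw [e1, e2]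
  exact tr_add_of_summable (summable_trTerm_rl (abs_comp_le_of_rightLoc hXV hYW hδ) hδ) (summable_trTerm_rl (abs_comp_le_of_rightLoc hXV hYK hδ) hδ)

/-! ## §2 Covariance of the Hessian when the first-order family reflects with a contact -/

/-- [folklore] **COVARIANCE OF THE RESOLVENT HESSIAN, BOUNDED LEG, FIRST-ORDER LAW WITH CONTACT.** If the bounded leg is relabelling-invariant (`Φ·A = A`), the second-order family obeys
the plain law and the first-order family obeys `V μ (ρ μ y) = σ μ • refK Φ (V μ y + Ct μ y)` with a contact family `Ct` localised at the same bonds, then EXACTLY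
`hess μ (ρ μ y) ν (ρ ν y′) = σ μ σ ν · (hess μ y ν y′ − ½·(bubble A (Ct μ y) (V ν y′) + bubble A (V μ y) (Ct ν y′) + bubble A (Ct μ y) (Ct ν y′)))` — the three CROSS WORDS displayed,
nothing assumed about them. -/
theorem hess_refl_bdd_contact (Φ : LegMap D F) {A : MKer D F} {V Ct : Fin D → (Fin D → ℤ) → MKer D F}
    {W : Fin D → (Fin D → ℤ) → Fin D → (Fin D → ℤ) → MKer D F} {B Cv Cc Cw δ : ℝ} {N : ℕ}
    (hA : Bdd A B) (hV : VertexFamily V N Cv δ) (hCt : VertexFamily Ct N Cc δ) (hW : VertexFamily₂ W N Cw δ) (hδ : 0 < δ) (hAr : refK Φ A = A)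
    (ρ : Fin D → (Fin D → ℤ) → (Fin D → ℤ)) (σ : Fin D → ℝ) (hVr : ∀ μ y, V μ (ρ μ y) = σ μ • refK Φ (V μ y + Ct μ y))
    (hWr : ∀ μ y ν y', W μ (ρ μ y) ν (ρ ν y') = (σ μ * σ ν) • refK Φ (W μ y ν y'))
    (μ : Fin D) (y : Fin D → ℤ) (ν : Fin D) (y' : Fin D → ℤ) :
    hess A V W μ (ρ μ y) ν (ρ ν y') = σ μ * σ ν * (hess A V W μ y ν y'
      - (1 / 2) * (bubble A (Ct μ y) (V ν y') + bubble A (V μ y) (Ct ν y') + bubble A (Ct μ y) (Ct ν y'))) := by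
  unfold ExpKernelCalculus.hess
  rw [hWr, hVr, hVr, tadpole_smul, bubble_smul_left, bubble_smul_right]
  conv_lhs => rw [← hAr]
  rw [tadpole_refK_bdd Φ hA (hW μ y ν y') hδ,
    bubble_refK_bdd Φ hA (biLoc_add (hV μ y) (hCt μ y)) (biLoc_add (hV ν y') (hCt ν y')) hδ,
    bubble_add_left_bdd hA (hV μ y) (hCt μ y) (biLoc_add (hV ν y') (hCt ν y')) hδ,
    bubble_add_right_bdd hA (hV μ y) (hV ν y') (hCt ν y') hδ, bubble_add_right_bdd hA (hCt μ y) (hV ν y') (hCt ν y') hδ]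
  ring

/-! ## §3 The difference-variable form -/

/-- [folklore] **THE DIFFERENCE-VARIABLE LAW WITH CONTACT.** Under block-translation covariance of `(A, V, W)` and the hypotheses of `hess_refl_bdd_contact` for the bond map `bondRefl α c`
with signs `reflSign α`:
`hessKer μ ν (εz + [μ=α]e_α − [ν=α]e_α) = ε_μ ε_ν · (hessKer μ ν z − ½·(bubble A (Ct μ 0) (V ν z) + bubble A (V μ 0) (Ct ν z) + bubble A (Ct μ 0) (Ct ν z)))`. -/
theorem hessKer_refl_bdd_contact (Φ : LegMap D F) {A : MKer D F} {V Ct : Fin D → (Fin D → ℤ) → MKer D F}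
    {W : Fin D → (Fin D → ℤ) → Fin D → (Fin D → ℤ) → MKer D F} {B Cv Cc Cw δ : ℝ} {N : ℕ}
    (hA : Bdd A B) (hV : VertexFamily V N Cv δ) (hCt : VertexFamily Ct N Cc δ) (hW : VertexFamily₂ W N Cw δ) (hδ : 0 < δ) (hcov : BlockCovariant A V W N)
    (hAr : refK Φ A = A) (α : Fin D) (c : ℤ)
    (hVr : ∀ μ y, V μ (bondRefl α c μ y) = reflSign α μ • refK Φ (V μ y + Ct μ y))
    (hWr : ∀ μ y ν y', W μ (bondRefl α c μ y) ν (bondRefl α c ν y') = (reflSign α μ * reflSign α ν) • refK Φ (W μ y ν y'))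
    (μ ν : Fin D) (z : Fin D → ℤ) :
    hessKer A V W μ ν (axisReflect α z + (if μ = α then unitVec α else 0) - (if ν = α then unitVec α else 0))
      = reflSign α μ * reflSign α ν * (hessKer A V W μ ν z
          - (1 / 2) * (bubble A (Ct μ 0) (V ν z) + bubble A (V μ 0) (Ct ν z) + bubble A (Ct μ 0) (Ct ν z))) := by
  have h := hess_refl_bdd_contact Φ hA hV hCt hW hδ hAr (bondRefl α c) (reflSign α) hVr hWr μ 0 ν z
  rw [hess_eq_hessKer hcov, hess_eq_hessKer hcov, sub_zero, bondRefl_sub, sub_zero] at h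
  exact h

/-! ## §4 The covariance corollary when the cross words vanish -/

/-- [folklore] **`AxisReflectionCovariant (fun μ ν z => hessKer A V W μ ν (−z))` FROM A FIRST-ORDER LAW WITH CONTACT WHOSE CROSS WORDS VANISH**: bounded leg, localised vertex families,
block covariance, and for every axis `α` a leg relabelling `Φα` (leaving the leg invariant), an offset `c` and a contact family `Ctα` such that the first-order family obeys the
law with contact, the second-order family the plain law, and the three cross words sum to zero at every `(μ, ν, z)` — the consumer's rules (for `Pker`: the (P-INV)∕(W1)-type letters)
are what produce the last hypothesis. -/
theorem axisReflectionCovariant_flip_hessKer_bdd_contact {A : MKer D F} {V : Fin D → (Fin D → ℤ) → MKer D F}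
    {W : Fin D → (Fin D → ℤ) → Fin D → (Fin D → ℤ) → MKer D F} {B Cv Cc Cw δ : ℝ} {N : ℕ}
    (hA : Bdd A B) (hV : VertexFamily V N Cv δ) (hW : VertexFamily₂ W N Cw δ) (hδ : 0 < δ) (hcov : BlockCovariant A V W N)
    (hAr : ∀ α : Fin D, ∃ Φα : LegMap D F, refK Φα A = A ∧ ∃ c : ℤ, ∃ Ctα : Fin D → (Fin D → ℤ) → MKer D F, VertexFamily Ctα N Cc δ ∧
      (∀ μ y, V μ (bondRefl α c μ y) = reflSign α μ • refK Φα (V μ y + Ctα μ y)) ∧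
      (∀ μ y ν y', W μ (bondRefl α c μ y) ν (bondRefl α c ν y') = (reflSign α μ * reflSign α ν) • refK Φα (W μ y ν y')) ∧
      (∀ μ ν z, bubble A (Ctα μ 0) (V ν z) + bubble A (V μ 0) (Ctα ν z) + bubble A (Ctα μ 0) (Ctα ν z) = 0)) :
    AxisReflectionCovariant (fun μ ν z => hessKer A V W μ ν (-z)) := by
  intro α μ ν z
  obtain ⟨Φα, hA', c, Ctα, hCt, hVr, hWr, hX⟩ := hAr α
  have h := hessKer_refl_bdd_contact Φα hA hV hCt hW hδ hcov hA' α c hVr hWr μ ν (-z)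
  rw [hX μ ν (-z), mul_zero, sub_zero] at h
  have e : -(axisReflect α z - (if μ = α then unitVec α else 0) + (if ν = α then unitVec α else 0))
      = axisReflect α (-z) + (if μ = α then unitVec α else 0) - (if ν = α then unitVec α else 0) := by
    funext i
    simp only [Pi.neg_apply, Pi.sub_apply, Pi.add_apply, axisReflect_apply]
    by_cases hi : i = α <;> by_cases hμ : μ = α <;> by_cases hν : ν = α <;> simp [hi, hμ, hν, unitVec_apply] <;> ring
  show hessKer A V W μ ν (-(axisReflect α z - (if μ = α then unitVec α else 0) + (if ν = α then unitVec α else 0)))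
    = reflSign α μ * reflSign α ν * hessKer A V W μ ν (-z)
  rw [e]
  exact h

end Summit.QuantumFields.BalabanUV.Beta.FP.KernelReflectionBoundedContact

end
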